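import Mathlib
import HarnessLib

/-!
# Exponential and sine sums with distinct unimodular nodes that tend to zero VANISH (pub-rhpf, barrier-typer gen 9)

**HONEST FRAMING. This is a long-odds MECHANISM SEARCH; no RH claims.** Pure Mathlib lemmas (no cell objects),
used by the typer's entry-tube file to compute the dial-space TRACE of thin tubes about `ζ` (the `(0, N)` entries of
an arithmetic deviation at a fixed height are sine samples `Σ_q Δ(q) sin(N ω_q)`, `ω_q = π log q / a`).

* `expSum_coeff_eq_zero` (PROVED): for pairwise distinct unimodular nodes `μ_j` (`j : Fin K`), if
  `Σ_j b_j μ_j^m → 0` as `m → ∞` then `b = 0` — Vandermonde inversion `b = D^{−m} V⁻¹ (g(m), …, g(m+K−1))` with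
  `|D| = 1`, so `|b_j| ≤ Σ_s |V⁻¹_{js}| |g(m+s)| → 0`. `expSum_coeff_eq_zero'`: any `Fintype` index.
* `sinSum_coeff_eq_zero` (PROVED): for injective `ω : ι → (0, 2π)` with `ω_k + ω_l ≠ 2π`, if
  `Σ_k c_k sin(m ω_k) → 0` then `c = 0` (nodes `e^{± i ω_k}` are pairwise distinct).
* `not_tendsto_sin_nat_mul` (PROVED): `sin(m ω) ↛ 0` for `ω ∈ (0, 2π) ∖ {π}`.
-/

set_option linter.dupNamespace false  -- the mandated namespace repeats `RiemannHypothesis`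

open Filter Topology Complex Finset Matrix

namespace Summit.RiemannHypothesis.RiemannHypothesis.Theorems.PfPersistence

/-! ## §1 Exponential sums: Vandermonde inversion -/

/-- **PROVED — EXP-SUM VANISHING (`Fin` index):** distinct unimodular nodes, `Σ_j b_j μ_j^m → 0` ⟹ `b = 0`. [folklore] -/
theorem expSum_coeff_eq_zero {K : ℕ} {μ : Fin K → ℂ} (hμ : Function.Injective μ) (hunit : ∀ j, ‖μ j‖ = 1)
    {b : Fin K → ℂ} (hg : Tendsto (fun m : ℕ => ∑ j, b j * μ j ^ m) atTop (𝓝 0)) : b = 0 := by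
  classical
  set V : Matrix (Fin K) (Fin K) ℂ := (Matrix.vandermonde μ)ᵀ with hV
  have hdet : IsUnit V.det := by
    rw [isUnit_iff_ne_zero, hV, Matrix.det_transpose]
    exact Matrix.det_vandermonde_ne_zero_iff.2 hμ
  have hG : ∀ m : ℕ, (fun s : Fin K => ∑ j, b j * μ j ^ (m + (s : ℕ))) = V *ᵥ fun j => μ j ^ m * b j := by
    intro m; ext s
    simp only [Matrix.mulVec, dotProduct, hV, Matrix.transpose_apply, Matrix.vandermonde_apply, pow_add]
    exact Finset.sum_congr rfl fun j _ => by ring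
  have hc : ∀ m : ℕ, (fun j => μ j ^ m * b j) = V⁻¹ *ᵥ fun s : Fin K => ∑ j, b j * μ j ^ (m + (s : ℕ)) := by
    intro m
    rw [hG, Matrix.mulVec_mulVec, Matrix.nonsing_inv_mul _ hdet, Matrix.one_mulVec]
  funext j
  have hb : ∀ m : ℕ, ‖b j‖ ≤ ∑ s, ‖V⁻¹ j s‖ * ‖∑ i, b i * μ i ^ (m + (s : ℕ))‖ := by
    intro m
    have h := congrFun (hc m) j
    simp only [Matrix.mulVec, dotProduct] at h
    have hn : ‖μ j ^ m * b j‖ = ‖b j‖ := by rw [norm_mul, norm_pow, hunit, one_pow, one_mul]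
    rw [← hn, h]
    exact (norm_sum_le _ _).trans (le_of_eq (Finset.sum_congr rfl fun s _ => norm_mul _ _))
  have hlim : Tendsto (fun m : ℕ => ∑ s : Fin K, ‖V⁻¹ j s‖ * ‖∑ i, b i * μ i ^ (m + (s : ℕ))‖)
      atTop (𝓝 0) := by
    rw [show (0 : ℝ) = ∑ s : Fin K, ‖V⁻¹ j s‖ * 0 by simp]
    refine tendsto_finsetSum _ fun s _ => Tendsto.const_mul _ ?_
    exact tendsto_norm_zero.comp (hg.comp (tendsto_add_atTop_nat (s : ℕ)))
  exact norm_le_zero_iff.1 (ge_of_tendsto' hlim hb)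

/-- PROVED: the same over any finite index type. [folklore] -/
theorem expSum_coeff_eq_zero' {ι : Type*} [Fintype ι] {μ : ι → ℂ} (hμ : Function.Injective μ)
    (hunit : ∀ k, ‖μ k‖ = 1) {b : ι → ℂ} (hg : Tendsto (fun m : ℕ => ∑ k, b k * μ k ^ m) atTop (𝓝 0)) :
    b = 0 := by
  classical
  set e := Fintype.equivFin ι
  have hfun : (fun m : ℕ => ∑ j, (b ∘ e.symm) j * (μ ∘ e.symm) j ^ m) = fun m => ∑ k, b k * μ k ^ m := by
    funext m
    simp only [Function.comp_apply]
    exact e.symm.sum_comp (fun k => b k * μ k ^ m)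
  have h := expSum_coeff_eq_zero (μ := μ ∘ e.symm) (b := b ∘ e.symm) (hμ.comp e.symm.injective)
    (fun j => hunit _) (by rw [hfun]; exact hg)
  funext k
  have := congrFun h (e k)
  simpa using this

/-! ## §2 Angles: `e^{i x}` determines `x` up to `2πℤ` -/

/-- PROVED: `e^{ix} = e^{iy}` ⟹ `x = y + 2πn`. [folklore] -/
theorem exists_int_of_cexp_mul_I_eq {x y : ℝ} (h : cexp ((x : ℂ) * I) = cexp ((y : ℂ) * I)) :
    ∃ n : ℤ, x = y + n * (2 * Real.pi) := by
  obtain ⟨n, hn⟩ := Complex.exp_eq_exp_iff_exists_int.1 h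
  refine ⟨n, ?_⟩
  have := congrArg Complex.im hn
  simp at this
  linarith

/-- PROVED: `|2πn| < 2π` ⟹ `n = 0`. [folklore] -/
theorem int_eq_zero_of_abs_lt_two_pi {n : ℤ} (h : |(n : ℝ) * (2 * Real.pi)| < 2 * Real.pi) : n = 0 := by
  rw [abs_mul, abs_of_pos Real.two_pi_pos] at h
  have h1 : |(n : ℝ)| < 1 := by
    by_contra hc
    rw [not_lt] at hc
    have := mul_le_mul_of_nonneg_right hc Real.two_pi_pos.le
    linarith
  have h2 : |n| < 1 := by exact_mod_cast h1
  have h3 := abs_lt.1 h2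
  omega

/-- PROVED: `0 < 2πn < 4π` ⟹ `n = 1`. [folklore] -/
theorem int_eq_one_of_lt {n : ℤ} (h0 : 0 < (n : ℝ) * (2 * Real.pi)) (h4 : (n : ℝ) * (2 * Real.pi) < 4 * Real.pi) :
    n = 1 := by
  have hπ := Real.pi_pos
  have h1 : (0 : ℝ) < n := by nlinarith
  have h2 : (n : ℝ) < 2 := by nlinarith
  have h1' : (0 : ℤ) < n := by exact_mod_cast h1
  have h2' : n < 2 := by exact_mod_cast h2
  omega

/-! ## §3 Sine sums -/

/-- PROVED: `c sin(m ω) = (−c i/2) (e^{iω})^m + (c i/2) (e^{−iω})^m`. [folklore] -/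
theorem real_sin_nat_mul_eq (c ω : ℝ) (m : ℕ) :
    ((c * Real.sin (m * ω) : ℝ) : ℂ) =
      -(c : ℂ) * I / 2 * cexp ((ω : ℂ) * I) ^ m + (c : ℂ) * I / 2 * cexp (((-ω : ℝ) : ℂ) * I) ^ m := by
  have hs : ((Real.sin (m * ω) : ℝ) : ℂ) = (cexp (-((m : ℂ) * ω * I)) - cexp ((m : ℂ) * ω * I)) * I / 2 := by
    rw [Complex.ofReal_sin]; push_cast; simp only [Complex.sin]; ring_nf
  rw [Complex.ofReal_mul, hs, ← Complex.exp_nat_mul, ← Complex.exp_nat_mul]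
  have e1 : (m : ℂ) * ((ω : ℂ) * I) = (m : ℂ) * ω * I := by ring
  have e2 : (m : ℂ) * (((-ω : ℝ) : ℂ) * I) = -((m : ℂ) * ω * I) := by push_cast; ring
  rw [e1, e2]; ring

/-- **PROVED — SINE-SUM VANISHING:** for injective `ω : ι → (0, 2π)` with `ω_k + ω_l ≠ 2π` (all `k, l`), if
`Σ_k c_k sin(m ω_k) → 0` as `m → ∞` then `c = 0`. [folklore] -/
theorem sinSum_coeff_eq_zero {ι : Type*} [Fintype ι] {ω : ι → ℝ} (hω : ∀ k, 0 < ω k ∧ ω k < 2 * Real.pi)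
    (hinj : Function.Injective ω) (hsum : ∀ k l, ω k + ω l ≠ 2 * Real.pi) {c : ι → ℝ}
    (hg : Tendsto (fun m : ℕ => ∑ k, c k * Real.sin (m * ω k)) atTop (𝓝 0)) : c = 0 := by
  classical
  let θ : ι ⊕ ι → ℝ := Sum.elim ω fun k => -ω k
  let μ : ι ⊕ ι → ℂ := fun x => cexp ((θ x : ℂ) * I)
  let b : ι ⊕ ι → ℂ := Sum.elim (fun k => -(c k : ℂ) * I / 2) fun k => (c k : ℂ) * I / 2
  have hunit : ∀ x, ‖μ x‖ = 1 := fun x => Complex.norm_exp_ofReal_mul_I _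
  have hμ : Function.Injective μ := by
    rintro (k | k) (l | l) h <;> obtain ⟨n, hn⟩ := exists_int_of_cexp_mul_I_eq h <;>
      simp only [θ, Sum.elim_inl, Sum.elim_inr] at hn
    · have h0 : n = 0 := int_eq_zero_of_abs_lt_two_pi (by
        rw [show (n : ℝ) * (2 * Real.pi) = ω k - ω l by linarith]
        exact abs_sub_lt_iff.2 ⟨by linarith [hω k, hω l], by linarith [hω k, hω l]⟩)
      subst h0
      exact congrArg Sum.inl (hinj (by simpa using hn))
    · have h1 : n = 1 := int_eq_one_of_lt (by linarith [hω k, hω l]) (by linarith [hω k, hω l])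
      have hn1 : (n : ℝ) = 1 := by exact_mod_cast h1
      rw [hn1] at hn
      exact absurd (by linarith : ω k + ω l = 2 * Real.pi) (hsum k l)
    · have h1 : -n = 1 :=
        int_eq_one_of_lt (n := -n) (by push_cast; linarith [hω k, hω l]) (by push_cast; linarith [hω k, hω l])
      have hn1 : (n : ℝ) = -1 := by
        have hc : ((-n : ℤ) : ℝ) = 1 := by exact_mod_cast h1
        push_cast at hc
        linarith
      rw [hn1] at hn
      exact absurd (by linarith : ω k + ω l = 2 * Real.pi) (hsum k l)
    · have h0 : n = 0 := int_eq_zero_of_abs_lt_two_pi (by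
        rw [show (n : ℝ) * (2 * Real.pi) = ω l - ω k by linarith]
        exact abs_sub_lt_iff.2 ⟨by linarith [hω k, hω l], by linarith [hω k, hω l]⟩)
      subst h0
      exact congrArg Sum.inr (hinj (by simp at hn; linarith))
  have hfun : (fun m : ℕ => (((∑ k, c k * Real.sin (m * ω k) : ℝ)) : ℂ)) = fun m => ∑ x, b x * μ x ^ m := by
    funext m
    rw [Complex.ofReal_sum, Fintype.sum_sum_type]
    simp only [b, μ, θ, Sum.elim_inl, Sum.elim_inr]
    rw [← Finset.sum_add_distrib]
    exact Finset.sum_congr rfl fun k _ => real_sin_nat_mul_eq (c k) (ω k) m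
  have hgC : Tendsto (fun m : ℕ => ∑ x, b x * μ x ^ m) atTop (𝓝 0) := by
    rw [← hfun]
    have := (Complex.continuous_ofReal.tendsto 0).comp hg
    rw [Complex.ofReal_zero] at this
    exact this
  have hb := expSum_coeff_eq_zero' hμ hunit hgC
  funext k
  have := congrFun hb (Sum.inr k)
  simpa [b] using this

/-- PROVED: `sin(m ω) ↛ 0` (`m → ∞` in `ℕ`) for `ω ∈ (0, 2π) ∖ {π}`. [folklore] -/
theorem not_tendsto_sin_nat_mul {ω : ℝ} (h0 : 0 < ω) (h2 : ω < 2 * Real.pi) (hπ : ω ≠ Real.pi) :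
    ¬ Tendsto (fun m : ℕ => Real.sin (m * ω)) atTop (𝓝 0) := by
  intro h
  have := sinSum_coeff_eq_zero (ι := Unit) (ω := fun _ => ω) (c := fun _ => 1) (fun _ => ⟨h0, h2⟩)
    (fun a b _ => Subsingleton.elim a b) (fun _ _ => fun h' => hπ (by linarith)) (by simpa using h)
  exact one_ne_zero (congrFun this ())

end Summit.RiemannHypothesis.RiemannHypothesis.Theorems.PfPersistence
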